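import Mathlib.LinearAlgebra.Matrix.Transvection
import Literature.Computability.AlgebraicComplexity.LMR13BoundaryOrbitProofs
import Literature.Computability.AlgebraicComplexity.DeterminantalComplexityProofs
import Literature.Computability.AlgebraicComplexity.OrbitClosureIrreducible
import HarnessLib

/-!
# Landsberg–Manivel–Ressayre 2013, Proposition 3.5.1 — `P_Λ ∉ End(W)·det_n` and
# `dc(P_{Λ,n}) > n = \overline{dc}(P_{Λ,n})` PROVED

Third proofs sibling of `Literature/Computability/AlgebraicComplexity/LMR13DualVarieties.lean`
(cell `val-lit`, typer `val-lit-t11`), continuing `LMR13BoundaryOrbitProofs.lean`. Honest framing: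
typed literature; VP ≠ VNP is NOT proved and nothing here is progress on it.

Printed statement (J. M. Landsberg, L. Manivel, N. Ressayre, Comment. Math. Helv. 88 (2013),
Prop. 3.5.1, p. 481; arXiv:1004.4802 `p0008.txt:L60–63`): "The polynomial `P_Λ` belongs to the
orbit closure of the determinant. Moreover, `\overline{GL(W)·P_Λ}` is an irreducible codimension one
component of the boundary of `\overline{GL(W)·[det_n]}`, not contained in `End(W)·[det_n]`. In
particular `\overline{dc}(P_{Λ,m}) = m < dc(P_{Λ,m})`."

Printed proof of the part formalised here (arXiv `p0008.txt:L94–97`): "Since the zero set is not a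
cone (i.e., the equation involves all the variables), `P_Λ` cannot be in `End(W)·det_n` which
consists of `GL(W)·det_n` plus cones", together with "[`\overline{GL(W)·P_Λ}`] is not contained in
the orbit of the determinant" (obtained in print from the stabiliser computation
`dim Stab[P_Λ] = 2n² = dim Stab[det_n] + 1`).

What is PROVED here, for every odd `n ≥ 3` (the scope of the typed fact `LMR2013_prop_3_5_1`):

* `eval_pLambda`, `eval_pLambda_conj` — `P_Λ(M) = (1/n) tr(adj(A) S)` on points and the covariance
  `P_Λ(g M gᵀ) = det(g)² P_Λ(M)` ("the action of `GL_n(ℂ)` on `M_n(ℂ)` by `M ↦ gMgᵗ` preserves `P_Λ`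
  up to scale", arXiv `p0008.txt:L79`).
* `pLambda_not_cone` — **`Z(P_Λ)` is not a cone**: no nonzero direction `u ∈ M_n(ℂ)` has
  `P_Λ(M + su) = P_Λ(M)` for all `M, s` (equivalently: no linear change of coordinates makes `P_Λ`
  independent of a variable). The printed text asserts this without proof; ours: translation
  invariance in the direction `u = u_A + u_S` forces `adj(A + s u_A) = adj(A)` for all skew `A`, which
  an explicit rank-`(n−1)` skew matrix `A₀` (`lmrSkewStd`) with `adj(A₀) = c·E₀₀`, `c ≠ 0`, refutes
  unless `u_A = 0`; then `tr(adj(A) u_S) = 0` for all skew `A` forces `u_S = 0` (diagonal entries via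
  `A₀` and its permutation conjugates, off-diagonal ones via transvection conjugates, using the
  covariance).
* `pLambda_not_mem_glOrbit_detPoly` — **`P_Λ ∉ GL(W)·det_n`**. DEVIATION from print (the stabiliser
  dimension count needs Lie-algebra / dimension machinery the tree lacks): we use the elementary
  invariant "`P_Λ` vanishes to order `n−1` along the space `Sym_n` of symmetric matrices"
  (`P_Λ(v + tw) = O(t^{n−1})` for `v` symmetric, since `adj(tA) = t^{n−1} adj(A)`), whereas
  `det_n(Y + tX) = O(t^{n−1})` for all `X` forces `rank Y ≤ 1` (reduction of `Y` to diagonal form by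
  transvections, Mathlib `Matrix.Pivot.exists_list_transvec_mul_mul_list_transvec_eq_diagonal`), and
  a linear space of matrices of rank `≤ 1` has dimension `≤ n < n(n+1)/2 = dim Sym_n` (it lies in
  `x ⊗ ℂⁿ` or in `ℂⁿ ⊗ y`).
* `pLambda_not_mem_endOrbit_detPoly` — **`P_Λ ∉ End(W)·det_n`** ("`End(W)·det_n` consists of
  `GL(W)·det_n` plus cones": a singular substitution matrix has a kernel vector, along which the
  substituted form is translation invariant).
* `not_orbitClosure_pLambda_subset_endOrbit` — conjunct (d) of `LMR2013_prop_3_5_1`: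
  `¬ (orbitClosure (pLambda n) ⊆ endOrbit det_n)`.
* `lt_determinantalComplexity_pLambda` — conjunct (f): **`n < dc(P_{Λ,n})`** (a size-`n` affine
  determinantal expression of a degree-`n` form is a point of `End(W)·det_n`,
  `X_pow_mul_rename_mem_endOrbit_detPoly`; `dc ≥ deg = n` by `totalDegree_le_determinantalComplexity_holds`),
  and with the landed `borderDc_pLambda`: **`\overline{dc}(P_{Λ,n}) = n < dc(P_{Λ,n})`**
  (`borderDc_pLambda_lt_determinantalComplexity`) — the source's explicit infinite family separating
  border from affine determinantal complexity is now a theorem of the tree.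

* Appendix (conjunct (b), elementary parts): `orbitClosure_pLambda_subset_orbitClosure_detPoly`
  (`Δ(P_Λ) ⊆ Δ(det_n)`), `orbitClosure_pLambda_isCoeffZariskiIrreducible` (`Δ(P_Λ)` is irreducible),
  `disjoint_glOrbit_pLambda_glOrbit_detPoly` (the orbits of `P_Λ` and `det_n` are disjoint).

The named fact `LMR2013_prop_3_5_1` STAYS (of conjunct (b) "irreducible component of the boundary"
the inclusion `Δ(P_Λ) ⊆ Δ(det_n) ∖ GL·det_n` — i.e. `det_n ∉ Δ(P_Λ)` — and the maximality remain, and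
(c) codimension one needs dimension theory); with `LMR13BoundaryOrbitProofs.lean` four of its six
conjuncts are proved. No new definitions of notions, no new facts (helper `def`s are explicit
matrices only).

## References

* [LandsbergManivelRessayre2013] Comment. Math. Helv. 88 (2013) 469–484, Prop. 3.5.1 and its proof
  (p. 481); arXiv:1004.4802 §3.5.
* [MulmuleySohoni2001] SIAM J. Comput. 31 (2001), §4 (`End·f ⊆ Δ[f]`, Prop. 4.4).
-/

noncomputable section

open MvPolynomial Matrix

namespace Literature.Computability.AlgebraicComplexity

/-! ### Evaluation of `P_Λ` at a matrix point and the `GL_n`-covariance -/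

section Eval

variable {n : ℕ}

/-- `P_Λ(M) = (1/n) · tr(adj(A) · S)` with `A = (M − Mᵀ)/2`, `S = (M + Mᵀ)/2`, for a point `M` with
coordinates in any commutative `ℂ`-algebra (LMR 2013 §3.5, "`P_Λ(M) = det_n(A,…,A,S)`", arXiv
`p0008.txt:L46–52`; the tree's `pLambda` is typed through Jacobi's formula).
[cite: LandsbergManivelRessayre2013, §3.5 (p. 480)] -/
theorem aeval_pLambda {R : Type*} [CommRing R] [Algebra ℂ R] (M : Matrix (Fin n) (Fin n) R) :
    aeval (fun p : Fin n × Fin n => M p.1 p.2) (pLambda n) =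
      (1 / (n : ℂ)) • (((1 / 2 : ℂ) • (M - Mᵀ)).adjugate * ((1 / 2 : ℂ) • (M + Mᵀ))).trace := by
  set φ : MvPolynomial (Fin n × Fin n) ℂ →ₐ[ℂ] R := aeval (fun p : Fin n × Fin n => M p.1 p.2)
    with hφ
  have hA : φ.mapMatrix (skewPartMatrix n) = (1 / 2 : ℂ) • (M - Mᵀ) := by
    ext i j
    simp [hφ, skewPartMatrix, Algebra.smul_def, mul_sub]
  have hS : φ.mapMatrix (symPartMatrix n) = (1 / 2 : ℂ) • (M + Mᵀ) := by
    ext i j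
    simp [hφ, symPartMatrix, Algebra.smul_def, mul_add]
  rw [pLambda, map_mul, MvPolynomial.algHom_C, ← Algebra.smul_def, AddMonoidHom.map_trace φ,
    ← AlgHom.mapMatrix_apply, map_mul, AlgHom.map_adjugate, hA, hS]

/-- `P_Λ(M) = (1/n) · tr(adj((M − Mᵀ)/2) · (M + Mᵀ)/2)` at a complex point.
[cite: LandsbergManivelRessayre2013, §3.5 (p. 480)] -/
theorem eval_pLambda (M : Matrix (Fin n) (Fin n) ℂ) :
    eval (fun p : Fin n × Fin n => M p.1 p.2) (pLambda n) =
      (1 / (n : ℂ)) * (((1 / 2 : ℂ) • (M - Mᵀ)).adjugate * ((1 / 2 : ℂ) • (M + Mᵀ))).trace := by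
  have h := aeval_pLambda (R := ℂ) M
  simpa only [MvPolynomial.aeval_eq_eval, smul_eq_mul] using h

/-- For `A` skew-symmetric and `S` symmetric, `P_Λ(A + S) = (1/n) · tr(adj(A) · S)`.
[cite: LandsbergManivelRessayre2013, §3.5 (p. 480)] -/
theorem eval_pLambda_skew_add_sym {A S : Matrix (Fin n) (Fin n) ℂ} (hA : Aᵀ = -A) (hS : Sᵀ = S) :
    eval (fun p : Fin n × Fin n => (A + S) p.1 p.2) (pLambda n) =
      (1 / (n : ℂ)) * (A.adjugate * S).trace := by
  rw [eval_pLambda]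
  have h1 : (1 / 2 : ℂ) • (A + S - (A + S)ᵀ) = A := by
    rw [transpose_add, hA, hS]
    ext i j
    simp only [Matrix.smul_apply, Matrix.sub_apply, Matrix.add_apply, Matrix.neg_apply, smul_eq_mul]
    ring
  have h2 : (1 / 2 : ℂ) • (A + S + (A + S)ᵀ) = S := by
    rw [transpose_add, hA, hS]
    ext i j
    simp only [Matrix.smul_apply, Matrix.add_apply, Matrix.neg_apply, smul_eq_mul]
    ring
  rw [h1, h2]

/-- The trace identity behind the covariance: `tr(adj(gAgᵀ) · gSgᵀ) = det(g)² · tr(adj(A) · S)`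
(any commutative ring; `adj(gAgᵀ) = adj(gᵀ) adj(A) adj(g)`, `adj(g) g = det g · 1`). [folklore] -/
private theorem trace_adjugate_conj_mul_conj {R : Type*} [CommRing R] (g A S : Matrix (Fin n) (Fin n) R) :
    ((g * A * gᵀ).adjugate * (g * S * gᵀ)).trace = g.det ^ 2 * (A.adjugate * S).trace := by
  rw [adjugate_mul_distrib, adjugate_mul_distrib]
  have h : gᵀ.adjugate * (A.adjugate * g.adjugate) * (g * S * gᵀ) =
      gᵀ.adjugate * (A.adjugate * (g.adjugate * g) * S * gᵀ) := by
    simp only [Matrix.mul_assoc]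
  rw [h, trace_mul_comm, Matrix.mul_assoc, mul_adjugate, adjugate_mul, det_transpose]
  simp only [Matrix.mul_smul, Matrix.mul_one, Matrix.smul_mul, trace_smul, smul_eq_mul]
  ring

/-- **Covariance of `P_Λ`** under `M ↦ g M gᵀ`: `P_Λ(gMgᵀ) = det(g)² P_Λ(M)` ("The action of
`GL_n(ℂ)` on `M_n(ℂ)` by `M ↦ gMgᵗ` preserves `P_Λ` up to scale", LMR 2013 p. 481, arXiv
`p0008.txt:L79`), for every square `g` (not only invertible ones) and points with coordinates in
any commutative `ℂ`-algebra. [cite: LandsbergManivelRessayre2013, Proposition 3.5.1, proof (p. 481)] -/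
theorem aeval_pLambda_conj {R : Type*} [CommRing R] [Algebra ℂ R] (g M : Matrix (Fin n) (Fin n) R) :
    aeval (fun p : Fin n × Fin n => (g * M * gᵀ) p.1 p.2) (pLambda n) =
      g.det ^ 2 * aeval (fun p : Fin n × Fin n => M p.1 p.2) (pLambda n) := by
  rw [aeval_pLambda, aeval_pLambda]
  have h1 : (1 / 2 : ℂ) • (g * M * gᵀ - (g * M * gᵀ)ᵀ) = g * ((1 / 2 : ℂ) • (M - Mᵀ)) * gᵀ := by
    rw [transpose_mul, transpose_mul, transpose_transpose]
    simp only [Matrix.mul_smul, Matrix.smul_mul, Matrix.mul_sub, Matrix.sub_mul, Matrix.mul_assoc]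
  have h2 : (1 / 2 : ℂ) • (g * M * gᵀ + (g * M * gᵀ)ᵀ) = g * ((1 / 2 : ℂ) • (M + Mᵀ)) * gᵀ := by
    rw [transpose_mul, transpose_mul, transpose_transpose]
    simp only [Matrix.mul_smul, Matrix.smul_mul, Matrix.mul_add, Matrix.add_mul, Matrix.mul_assoc]
  rw [h1, h2, trace_adjugate_conj_mul_conj]
  exact (mul_smul_comm _ _ _).symm

/-- Covariance at complex points: `P_Λ(gMgᵀ) = det(g)² · P_Λ(M)`.
[cite: LandsbergManivelRessayre2013, Proposition 3.5.1, proof (p. 481)] -/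
theorem eval_pLambda_conj (g M : Matrix (Fin n) (Fin n) ℂ) :
    eval (fun p : Fin n × Fin n => (g * M * gᵀ) p.1 p.2) (pLambda n) =
      g.det ^ 2 * eval (fun p : Fin n × Fin n => M p.1 p.2) (pLambda n) := by
  have h := aeval_pLambda_conj (R := ℂ) g M
  simpa only [MvPolynomial.aeval_eq_eval] using h

end Eval

/-! ### An explicit skew-symmetric matrix of rank `n − 1` and its adjugate -/

section SkewStd

variable (h : ℕ)

/-- The standard symplectic matrix `J = [[0, −1], [1, 0]]` of size `2h`, on the index type
`Fin (h + h)` (Mathlib's `Matrix.J (Fin h) ℂ` reindexed along `Fin h ⊕ Fin h ≃ Fin (h + h)`). An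
explicit matrix used as a witness; not a notion of the source. [folklore] -/
def lmrSympl : Matrix (Fin (h + h)) (Fin (h + h)) ℂ :=
  Matrix.reindex finSumFinEquiv finSumFinEquiv (Matrix.J (Fin h) ℂ)

/-- `J² = −1`. [folklore] -/
private theorem lmrSympl_mul_self : lmrSympl h * lmrSympl h = -1 := by
  rw [lmrSympl, Matrix.reindex_apply, Matrix.submatrix_mul_equiv, Matrix.J_squared]
  ext i j
  simp only [Matrix.submatrix_apply, Matrix.neg_apply, Matrix.one_apply,
    EmbeddingLike.apply_eq_iff_eq]

/-- `Jᵀ = −J`. [folklore] -/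
private theorem lmrSympl_transpose : (lmrSympl h)ᵀ = -lmrSympl h := by
  ext i j
  have := congr_fun (congr_fun (Matrix.J_transpose (Fin h) ℂ) (finSumFinEquiv.symm i))
    (finSumFinEquiv.symm j)
  simpa [lmrSympl] using this

/-- `det J ≠ 0`. [folklore] -/
private theorem det_lmrSympl_ne_zero : (lmrSympl h).det ≠ 0 := by
  rw [lmrSympl, Matrix.det_reindex_self]
  exact (Matrix.isUnit_det_J (Fin h) ℂ).ne_zero

/-- `J` has trivial kernel: `J v = 0 ⇒ v = 0`. [folklore] -/
private theorem eq_zero_of_lmrSympl_mulVec_eq_zero {v : Fin (h + h) → ℂ} (hv : lmrSympl h *ᵥ v = 0) :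
    v = 0 := by
  have h2 : lmrSympl h *ᵥ (lmrSympl h *ᵥ v) = 0 := by rw [hv, Matrix.mulVec_zero]
  rw [Matrix.mulVec_mulVec, lmrSympl_mul_self, Matrix.neg_mulVec, Matrix.one_mulVec,
    neg_eq_zero] at h2
  exact h2

/-- **The witness `A₀`**: the skew-symmetric matrix of odd size `n = 2h + 1` with the index `0`
isolated (zero row and column) and the symplectic block `J` on the indices `1, …, 2h`; it has rank
`n − 1`, kernel `ℂ e₀`, and `adj(A₀) = det(J) · E₀₀` (`adjugate_lmrSkewStd`). An explicit matrix used
as a witness in the proof that `Z(P_Λ)` is not a cone; not a notion of the source. [folklore] -/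
def lmrSkewStd : Matrix (Fin (h + h + 1)) (Fin (h + h + 1)) ℂ :=
  Matrix.of fun i j => Fin.cases (motive := fun _ => ℂ) 0
    (fun a => Fin.cases (motive := fun _ => ℂ) 0 (fun b => lmrSympl h a b) j) i

/-- Row `0` of `A₀` vanishes. [folklore] -/
@[simp]
private theorem lmrSkewStd_zero_left (j : Fin (h + h + 1)) : lmrSkewStd h 0 j = 0 := by
  simp [lmrSkewStd]

/-- Column `0` of `A₀` vanishes. [folklore] -/
@[simp]
private theorem lmrSkewStd_zero_right (i : Fin (h + h + 1)) : lmrSkewStd h i 0 = 0 := by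
  refine Fin.cases ?_ (fun a => ?_) i <;> simp [lmrSkewStd]

/-- The block of `A₀` on the indices `≥ 1` is `J`. [folklore] -/
@[simp]
private theorem lmrSkewStd_succ_succ (a b : Fin (h + h)) :
    lmrSkewStd h a.succ b.succ = lmrSympl h a b := by
  simp [lmrSkewStd]

/-- `A₀` is skew-symmetric. [folklore] -/
private theorem lmrSkewStd_transpose : (lmrSkewStd h)ᵀ = -lmrSkewStd h := by
  ext i j
  refine Fin.cases ?_ (fun a => ?_) i <;> refine Fin.cases ?_ (fun b => ?_) j
  · simp
  · simp
  · simp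
  · rw [Matrix.transpose_apply, Matrix.neg_apply, lmrSkewStd_succ_succ, lmrSkewStd_succ_succ,
      ← Matrix.transpose_apply (lmrSympl h) a b, lmrSympl_transpose, Matrix.neg_apply]

/-- The `(0,0)`-minor of `A₀` is `J`. [folklore] -/
private theorem lmrSkewStd_submatrix_succ :
    (lmrSkewStd h).submatrix Fin.succ Fin.succ = lmrSympl h := by
  ext a b
  simp

/-- A skew-symmetric complex matrix of odd size has zero determinant. [folklore] -/
private theorem det_eq_zero_of_transpose_eq_neg_of_odd {m : ℕ} (hm : Odd m) {A : Matrix (Fin m) (Fin m) ℂ}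
    (hA : Aᵀ = -A) : A.det = 0 := by
  have h1 := congrArg Matrix.det hA
  rw [Matrix.det_transpose, Matrix.det_neg, Fintype.card_fin, hm.neg_one_pow, neg_one_mul] at h1
  have h2 : (2 : ℂ) * A.det = 0 := by rw [two_mul]; nth_rw 2 [h1]; exact add_neg_cancel _
  exact (mul_eq_zero.mp h2).resolve_left two_ne_zero

/-- `det A₀ = 0`. [folklore] -/
private theorem det_lmrSkewStd : (lmrSkewStd h).det = 0 :=
  det_eq_zero_of_transpose_eq_neg_of_odd (by exact ⟨h, by ring⟩) (lmrSkewStd_transpose h)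

/-- The kernel of `A₀` is `ℂ e₀`: `A₀ v = 0` forces `v_j = 0` for `j ≠ 0`. [folklore] -/
private theorem apply_succ_eq_zero_of_lmrSkewStd_mulVec {v : Fin (h + h + 1) → ℂ}
    (hv : lmrSkewStd h *ᵥ v = 0) (b : Fin (h + h)) : v b.succ = 0 := by
  have hw : lmrSympl h *ᵥ (fun b => v b.succ) = 0 := by
    funext a
    have := congr_fun hv a.succ
    rw [Matrix.mulVec, dotProduct, Fin.sum_univ_succ] at this
    simpa [Matrix.mulVec, dotProduct] using this
  exact congr_fun (eq_zero_of_lmrSympl_mulVec_eq_zero h hw) b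

/-- Likewise for the cokernel: `vᵀ A₀ = 0` forces `v_j = 0` for `j ≠ 0`. [folklore] -/
private theorem apply_succ_eq_zero_of_vecMul_lmrSkewStd {v : Fin (h + h + 1) → ℂ}
    (hv : v ᵥ* lmrSkewStd h = 0) (b : Fin (h + h)) : v b.succ = 0 := by
  refine apply_succ_eq_zero_of_lmrSkewStd_mulVec h ?_ b
  rw [← Matrix.vecMul_transpose, lmrSkewStd_transpose, Matrix.vecMul_neg, hv, neg_zero]

/-- **`adj(A₀) = det(J) · E₀₀`** — the adjugate of the rank-`(n−1)` skew matrix `A₀` is the rank-one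
matrix supported at `(0,0)` (its columns lie in `ker A₀ = ℂe₀`, its rows in `ker A₀ᵀ = ℂe₀`, and its
`(0,0)` entry is the minor `det J`). [folklore] -/
private theorem adjugate_lmrSkewStd :
    (lmrSkewStd h).adjugate = Matrix.single 0 0 (lmrSympl h).det := by
  have hcol : ∀ (a : Fin (h + h)) (j : Fin (h + h + 1)), (lmrSkewStd h).adjugate a.succ j = 0 := by
    intro a j
    have hmul := Matrix.mul_adjugate (lmrSkewStd h)
    rw [det_lmrSkewStd, zero_smul] at hmul
    have hv : lmrSkewStd h *ᵥ (fun i => (lmrSkewStd h).adjugate i j) = 0 := by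
      funext i
      have := congr_fun (congr_fun hmul i) j
      simpa [Matrix.mul_apply, Matrix.mulVec, dotProduct] using this
    exact apply_succ_eq_zero_of_lmrSkewStd_mulVec h hv a
  have hrow : ∀ (i : Fin (h + h + 1)) (b : Fin (h + h)), (lmrSkewStd h).adjugate i b.succ = 0 := by
    intro i b
    have hmul := Matrix.adjugate_mul (lmrSkewStd h)
    rw [det_lmrSkewStd, zero_smul] at hmul
    have hv : (fun j => (lmrSkewStd h).adjugate i j) ᵥ* lmrSkewStd h = 0 := by
      funext j
      have := congr_fun (congr_fun hmul i) j
      simpa [Matrix.mul_apply, Matrix.vecMul, dotProduct] using this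
    exact apply_succ_eq_zero_of_vecMul_lmrSkewStd h hv b
  ext i j
  refine Fin.cases ?_ (fun a => ?_) i <;> refine Fin.cases ?_ (fun b => ?_) j
  · rw [Matrix.single_apply_same, Matrix.adjugate_fin_succ_eq_det_submatrix, Fin.succAbove_zero,
      lmrSkewStd_submatrix_succ]
    simp
  · rw [hrow, Matrix.single_apply_of_ne]
    exact fun hh => Fin.succ_ne_zero b hh.2.symm
  · rw [hcol, Matrix.single_apply_of_ne]
    exact fun hh => Fin.succ_ne_zero a hh.1.symm
  · rw [hcol, Matrix.single_apply_of_ne]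
    exact fun hh => Fin.succ_ne_zero a hh.1.symm

/-- The adjugate of `A₀` does not vanish: its `(0,0)` entry is `det J ≠ 0`. [folklore] -/
private theorem adjugate_lmrSkewStd_zero_zero : (lmrSkewStd h).adjugate 0 0 = (lmrSympl h).det := by
  rw [adjugate_lmrSkewStd, Matrix.single_apply_same]

/-- **Key rigidity of `A₀`**: if a skew-symmetric `U` satisfies `adj(A₀ + U) = adj(A₀)`, then the
`0`-th column of `U` vanishes (from `(A₀ + U) adj(A₀ + U) = det · 1` and `adj(A₀) = c E₀₀`, `c ≠ 0`).
[folklore] -/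
private theorem col_zero_eq_zero_of_adjugate_add_eq {U : Matrix (Fin (h + h + 1)) (Fin (h + h + 1)) ℂ}
    (hU : Uᵀ = -U) (hadj : (lmrSkewStd h + U).adjugate = (lmrSkewStd h).adjugate)
    (k : Fin (h + h + 1)) : U k 0 = 0 := by
  refine Fin.cases ?_ (fun a => ?_) k
  · -- diagonal entry of a skew matrix
    have h1 := congr_fun (congr_fun hU 0) 0
    rw [Matrix.transpose_apply, Matrix.neg_apply] at h1
    have h2 : (2 : ℂ) * U 0 0 = 0 := by rw [two_mul]; nth_rw 2 [h1]; exact add_neg_cancel _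
    exact (mul_eq_zero.mp h2).resolve_left two_ne_zero
  · have hmul := Matrix.mul_adjugate (lmrSkewStd h + U)
    rw [hadj, adjugate_lmrSkewStd] at hmul
    have h1 := congr_fun (congr_fun hmul a.succ) 0
    rw [Matrix.mul_single_apply_same, Matrix.smul_apply, Matrix.one_apply_ne (Fin.succ_ne_zero a),
      smul_zero, Matrix.add_apply, lmrSkewStd_zero_right, zero_add] at h1
    exact (mul_eq_zero.mp h1).resolve_right (det_lmrSympl_ne_zero h)

end SkewStd

/-! ### `Z(P_Λ)` is not a cone -/

section Cone

/-- `tr(X · E_{ij}(c)) = c · X_{ji}`. [folklore] -/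
private theorem trace_mul_single {m : Type*} [Fintype m] [DecidableEq m] {R : Type*} [CommRing R]
    (X : Matrix m m R) (i j : m) (c : R) : (X * Matrix.single i j c).trace = c * X j i := by
  rw [Matrix.trace_mul_comm, Matrix.trace]
  simp only [Matrix.diag_apply]
  rw [Finset.sum_eq_single i (fun k _ hk => Matrix.single_mul_apply_of_ne c i j k k hk X)
    (fun hi => (hi (Finset.mem_univ i)).elim), Matrix.single_mul_apply_same]

/-- Symmetric matrices are separated by the pairings `X ↦ tr(X S)`, `S` symmetric (test with
`S = E_{ij} + E_{ji}`; characteristic `≠ 2`). [folklore] -/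
private theorem eq_of_trace_mul_sym_eq {m : Type*} [Fintype m] [DecidableEq m] {X Y : Matrix m m ℂ}
    (hX : Xᵀ = X) (hY : Yᵀ = Y)
    (hXY : ∀ S : Matrix m m ℂ, Sᵀ = S → (X * S).trace = (Y * S).trace) : X = Y := by
  ext i j
  have hS : (Matrix.single i j (1 : ℂ) + Matrix.single j i 1)ᵀ =
      Matrix.single i j (1 : ℂ) + Matrix.single j i 1 := by
    rw [Matrix.transpose_add, Matrix.transpose_single, Matrix.transpose_single, add_comm]
  have h1 := hXY _ hS
  rw [Matrix.mul_add, Matrix.mul_add, Matrix.trace_add, Matrix.trace_add, trace_mul_single,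
    trace_mul_single, trace_mul_single, trace_mul_single] at h1
  have hx : X j i = X i j := by rw [← Matrix.transpose_apply X i j, hX]
  have hy : Y j i = Y i j := by rw [← Matrix.transpose_apply Y i j, hY]
  rw [hx, hy, one_mul, one_mul, ← two_mul, ← two_mul] at h1
  exact mul_left_cancel₀ two_ne_zero h1

/-- The adjugate of a skew-symmetric matrix of odd size is symmetric
(`adj(A)ᵀ = adj(Aᵀ) = adj(−A) = (−1)^{n−1} adj(A)`). [folklore] -/
private theorem adjugate_transpose_of_skew_odd (h : ℕ) {A : Matrix (Fin (h + h + 1)) (Fin (h + h + 1)) ℂ}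
    (hA : Aᵀ = -A) : (A.adjugate)ᵀ = A.adjugate := by
  rw [Matrix.adjugate_transpose, hA, ← neg_one_smul ℂ A, Matrix.adjugate_smul, Fintype.card_fin,
    Nat.add_sub_cancel, Even.neg_one_pow ⟨h, rfl⟩, one_smul]

/-- Conjugation by a permutation matrix permutes entries: `(P_σ u P_σᵀ)_{kl} = u_{σk, σl}`. [folklore] -/
private theorem permMatrix_mul_mul_transpose_apply {m : Type*} [Fintype m] [DecidableEq m]
    (σ : Equiv.Perm m) (u : Matrix m m ℂ) (k l : m) :
    (σ.permMatrix ℂ * u * (σ.permMatrix ℂ)ᵀ) k l = u (σ k) (σ l) := by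
  rw [Matrix.transpose_permMatrix, Equiv.Perm.permMatrix, Equiv.Perm.permMatrix,
    PEquiv.toMatrix_toPEquiv_mul, PEquiv.mul_toMatrix_toPEquiv]
  simp [Equiv.Perm.inv_def]

/-- A permutation matrix has nonzero (indeed unit) determinant. [folklore] -/
private theorem isUnit_det_permMatrix {m : Type*} [Fintype m] [DecidableEq m] (σ : Equiv.Perm m) :
    IsUnit (σ.permMatrix ℂ).det := by
  rw [Matrix.det_permutation]
  exact (Units.isUnit _).map (Int.castRingHom ℂ)

variable (h : ℕ)

/-- **Covariance transports cone directions**: if `P_Λ` is translation invariant in the direction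
`u`, then also in the direction `g u gᵀ` for every invertible `g` (from `P_Λ(gMgᵀ) = det(g)² P_Λ(M)`).
[cite: LandsbergManivelRessayre2013, Proposition 3.5.1, proof (p. 481)] -/
theorem pLambda_translate_conj {n : ℕ} {u : Matrix (Fin n) (Fin n) ℂ}
    (hu : ∀ (M : Matrix (Fin n) (Fin n) ℂ) (s : ℂ),
      eval (fun p : Fin n × Fin n => (M + s • u) p.1 p.2) (pLambda n) =
        eval (fun p : Fin n × Fin n => M p.1 p.2) (pLambda n))
    {g : Matrix (Fin n) (Fin n) ℂ} (hg : IsUnit g.det) (M : Matrix (Fin n) (Fin n) ℂ) (s : ℂ) :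
    eval (fun p : Fin n × Fin n => (M + s • (g * u * gᵀ)) p.1 p.2) (pLambda n) =
      eval (fun p : Fin n × Fin n => M p.1 p.2) (pLambda n) := by
  have hM : g * (g⁻¹ * M * g⁻¹ᵀ) * gᵀ = M := by
    rw [show g * (g⁻¹ * M * g⁻¹ᵀ) * gᵀ = (g * g⁻¹) * M * (g * g⁻¹)ᵀ by
      rw [Matrix.transpose_mul]; simp only [Matrix.mul_assoc], Matrix.mul_nonsing_inv _ hg]
    simp
  have key : M + s • (g * u * gᵀ) = g * (g⁻¹ * M * g⁻¹ᵀ + s • u) * gᵀ := by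
    rw [Matrix.mul_add, Matrix.add_mul, hM, Matrix.mul_smul, Matrix.smul_mul]
  rw [key, eval_pLambda_conj, hu, ← eval_pLambda_conj, hM]

/-- Translation invariance of `P_Λ` in the direction `u = u_A + u_S` forces
`adj(A + s u_A) = adj(A)` for every skew-symmetric `A` (compare the parts linear in the
symmetric argument `S` of `P_Λ(A + S) = (1/n) tr(adj(A) S)`). [folklore] -/
private theorem adjugate_add_smul_skewPart_eq {u : Matrix (Fin (h + h + 1)) (Fin (h + h + 1)) ℂ}
    (hu : ∀ (M : Matrix (Fin (h + h + 1)) (Fin (h + h + 1)) ℂ) (s : ℂ),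
      eval (fun p : Fin (h + h + 1) × Fin (h + h + 1) => (M + s • u) p.1 p.2) (pLambda (h + h + 1)) =
        eval (fun p : Fin (h + h + 1) × Fin (h + h + 1) => M p.1 p.2) (pLambda (h + h + 1)))
    {A : Matrix (Fin (h + h + 1)) (Fin (h + h + 1)) ℂ} (hA : Aᵀ = -A) (s : ℂ) :
    (A + s • ((1 / 2 : ℂ) • (u - uᵀ))).adjugate = A.adjugate := by
  set uA : Matrix (Fin (h + h + 1)) (Fin (h + h + 1)) ℂ := (1 / 2 : ℂ) • (u - uᵀ) with huA_def
  set uS : Matrix (Fin (h + h + 1)) (Fin (h + h + 1)) ℂ := (1 / 2 : ℂ) • (u + uᵀ) with huS_def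
  have huA : uAᵀ = -uA := by
    rw [huA_def, Matrix.transpose_smul, Matrix.transpose_sub, Matrix.transpose_transpose,
      ← smul_neg, neg_sub]
  have huS : uSᵀ = uS := by
    rw [huS_def, Matrix.transpose_smul, Matrix.transpose_add, Matrix.transpose_transpose,
      add_comm uᵀ u]
  have hsplit : u = uA + uS := by
    rw [huA_def, huS_def, ← smul_add]
    ext i j
    simp only [Matrix.smul_apply, Matrix.add_apply, Matrix.sub_apply, Matrix.transpose_apply,
      smul_eq_mul]
    ring
  have hn : (1 / ((h + h + 1 : ℕ) : ℂ)) ≠ 0 := one_div_ne_zero (Nat.cast_ne_zero.mpr (by omega))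
  have hAs : (A + s • uA)ᵀ = -(A + s • uA) := by
    rw [Matrix.transpose_add, Matrix.transpose_smul, hA, huA, smul_neg, neg_add]
  -- the identity `tr(adj(A + s u_A)(S + s u_S)) = tr(adj(A) S)` for every symmetric `S`
  have hid : ∀ S : Matrix (Fin (h + h + 1)) (Fin (h + h + 1)) ℂ, Sᵀ = S →
      ((A + s • uA).adjugate * (S + s • uS)).trace = (A.adjugate * S).trace := by
    intro S hS
    have hSs : (S + s • uS)ᵀ = S + s • uS := by
      rw [Matrix.transpose_add, Matrix.transpose_smul, hS, huS]
    have h1 := hu (A + S) s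
    rw [show A + S + s • u = (A + s • uA) + (S + s • uS) by
        rw [hsplit, smul_add]; abel,
      eval_pLambda_skew_add_sym hAs hSs, eval_pLambda_skew_add_sym hA hS] at h1
    exact mul_left_cancel₀ hn h1
  refine eq_of_trace_mul_sym_eq (adjugate_transpose_of_skew_odd h hAs)
    (adjugate_transpose_of_skew_odd h hA) fun S hS => ?_
  have h0 := hid 0 Matrix.transpose_zero
  rw [zero_add, Matrix.mul_zero, Matrix.trace_zero] at h0
  have h1 := hid S hS
  rw [Matrix.mul_add, Matrix.trace_add, h0, add_zero] at h1
  exact h1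

/-- Hence the `0`-th column of the skew part `u_A` of a cone direction vanishes (rigidity of the
witness `A₀`, `col_zero_eq_zero_of_adjugate_add_eq`). [folklore] -/
private theorem skewPart_col_zero_eq_zero {u : Matrix (Fin (h + h + 1)) (Fin (h + h + 1)) ℂ}
    (hu : ∀ (M : Matrix (Fin (h + h + 1)) (Fin (h + h + 1)) ℂ) (s : ℂ),
      eval (fun p : Fin (h + h + 1) × Fin (h + h + 1) => (M + s • u) p.1 p.2) (pLambda (h + h + 1)) =
        eval (fun p : Fin (h + h + 1) × Fin (h + h + 1) => M p.1 p.2) (pLambda (h + h + 1)))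
    (k : Fin (h + h + 1)) : ((1 / 2 : ℂ) • (u - uᵀ)) k 0 = 0 := by
  have huA : ((1 / 2 : ℂ) • (u - uᵀ))ᵀ = -((1 / 2 : ℂ) • (u - uᵀ)) := by
    rw [Matrix.transpose_smul, Matrix.transpose_sub, Matrix.transpose_transpose, ← smul_neg, neg_sub]
  refine col_zero_eq_zero_of_adjugate_add_eq h huA ?_ k
  have := adjugate_add_smul_skewPart_eq h hu (lmrSkewStd_transpose h) 1
  rwa [one_smul] at this

/-- **A cone direction is symmetric**: its skew part vanishes (conjugate by the transpositions
`(0 j)` to move every column to position `0`). [folklore] -/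
private theorem transpose_eq_self_of_translate {u : Matrix (Fin (h + h + 1)) (Fin (h + h + 1)) ℂ}
    (hu : ∀ (M : Matrix (Fin (h + h + 1)) (Fin (h + h + 1)) ℂ) (s : ℂ),
      eval (fun p : Fin (h + h + 1) × Fin (h + h + 1) => (M + s • u) p.1 p.2) (pLambda (h + h + 1)) =
        eval (fun p : Fin (h + h + 1) × Fin (h + h + 1) => M p.1 p.2) (pLambda (h + h + 1))) :
    uᵀ = u := by
  -- every entry of `u - uᵀ` vanishes
  suffices hzero : ∀ k j : Fin (h + h + 1), (u - uᵀ) k j = 0 by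
    ext i j
    have := hzero j i
    rw [Matrix.sub_apply, Matrix.transpose_apply, sub_eq_zero] at this
    rw [Matrix.transpose_apply, this]
  intro k j
  set σ : Equiv.Perm (Fin (h + h + 1)) := Equiv.swap 0 j with hσ
  have hu' := pLambda_translate_conj hu (isUnit_det_permMatrix σ)
  have hcol := skewPart_col_zero_eq_zero h hu' (σ k)
  have hconj : (1 / 2 : ℂ) • (σ.permMatrix ℂ * u * (σ.permMatrix ℂ)ᵀ -
      (σ.permMatrix ℂ * u * (σ.permMatrix ℂ)ᵀ)ᵀ) =
      σ.permMatrix ℂ * ((1 / 2 : ℂ) • (u - uᵀ)) * (σ.permMatrix ℂ)ᵀ := by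
    rw [Matrix.transpose_mul, Matrix.transpose_mul, Matrix.transpose_transpose]
    simp only [Matrix.mul_smul, Matrix.smul_mul, Matrix.mul_sub, Matrix.sub_mul, Matrix.mul_assoc]
  rw [hconj, permMatrix_mul_mul_transpose_apply, hσ, Equiv.swap_apply_self,
    Equiv.swap_apply_left, Matrix.smul_apply, smul_eq_mul, mul_eq_zero] at hcol
  exact hcol.resolve_left (by norm_num)

/-- For a SYMMETRIC cone direction `u`: `u₀₀ = 0` (test against the witness `A₀`:
`P_Λ(A₀ + u) = (1/n) tr(adj(A₀) u) = (det J / n) · u₀₀` while `P_Λ(A₀) = 0`). [folklore] -/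
private theorem apply_zero_zero_eq_zero_of_translate {u : Matrix (Fin (h + h + 1)) (Fin (h + h + 1)) ℂ}
    (hu : ∀ (M : Matrix (Fin (h + h + 1)) (Fin (h + h + 1)) ℂ) (s : ℂ),
      eval (fun p : Fin (h + h + 1) × Fin (h + h + 1) => (M + s • u) p.1 p.2) (pLambda (h + h + 1)) =
        eval (fun p : Fin (h + h + 1) × Fin (h + h + 1) => M p.1 p.2) (pLambda (h + h + 1)))
    (hsym : uᵀ = u) : u 0 0 = 0 := by
  have hn : (1 / ((h + h + 1 : ℕ) : ℂ)) ≠ 0 := one_div_ne_zero (Nat.cast_ne_zero.mpr (by omega))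
  have h1 := hu (lmrSkewStd h) 1
  have h0 : eval (fun p : Fin (h + h + 1) × Fin (h + h + 1) => lmrSkewStd h p.1 p.2)
      (pLambda (h + h + 1)) = 0 := by
    have := eval_pLambda_skew_add_sym (n := h + h + 1) (lmrSkewStd_transpose h)
      (Matrix.transpose_zero : (0 : Matrix (Fin (h + h + 1)) (Fin (h + h + 1)) ℂ)ᵀ = 0)
    rw [add_zero] at this
    rw [this, Matrix.mul_zero, Matrix.trace_zero, mul_zero]
  rw [one_smul, eval_pLambda_skew_add_sym (lmrSkewStd_transpose h) hsym, h0, mul_eq_zero,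
    adjugate_lmrSkewStd, Matrix.trace_mul_comm, trace_mul_single, mul_eq_zero] at h1
  exact (h1.resolve_left hn).resolve_left (det_lmrSympl_ne_zero h)

/-- For a symmetric cone direction `u`: the whole `0`-th row vanishes (diagonal entries by
permutation conjugates of the previous lemma, then `u_{0j}` by the transvection conjugate
`(1 + E_{0j}) u (1 + E_{0j})ᵀ`, whose `(0,0)` entry is `u₀₀ + 2u_{0j} + u_{jj}`). [folklore] -/
private theorem apply_zero_eq_zero_of_translate {u : Matrix (Fin (h + h + 1)) (Fin (h + h + 1)) ℂ}
    (hu : ∀ (M : Matrix (Fin (h + h + 1)) (Fin (h + h + 1)) ℂ) (s : ℂ),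
      eval (fun p : Fin (h + h + 1) × Fin (h + h + 1) => (M + s • u) p.1 p.2) (pLambda (h + h + 1)) =
        eval (fun p : Fin (h + h + 1) × Fin (h + h + 1) => M p.1 p.2) (pLambda (h + h + 1)))
    (hsym : uᵀ = u) (j : Fin (h + h + 1)) : u 0 j = 0 := by
  -- diagonal entries vanish
  have hdiag : ∀ i : Fin (h + h + 1), u i i = 0 := by
    intro i
    set σ : Equiv.Perm (Fin (h + h + 1)) := Equiv.swap 0 i with hσ
    have hu' := pLambda_translate_conj hu (isUnit_det_permMatrix σ)
    have hsym' : (σ.permMatrix ℂ * u * (σ.permMatrix ℂ)ᵀ)ᵀ =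
        σ.permMatrix ℂ * u * (σ.permMatrix ℂ)ᵀ := by
      rw [Matrix.transpose_mul, Matrix.transpose_mul, Matrix.transpose_transpose, hsym,
        Matrix.mul_assoc]
    have h0 := apply_zero_zero_eq_zero_of_translate h hu' hsym'
    rwa [permMatrix_mul_mul_transpose_apply, hσ, Equiv.swap_apply_left] at h0
  by_cases hj : j = 0
  · rw [hj]; exact hdiag 0
  -- the transvection conjugate
  set T : Matrix (Fin (h + h + 1)) (Fin (h + h + 1)) ℂ := Matrix.transvection 0 j 1 with hT
  have hTdet : IsUnit T.det := by
    rw [hT, Matrix.det_transvection_of_ne 0 j (Ne.symm hj)]; exact isUnit_one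
  have hu' := pLambda_translate_conj hu hTdet
  have hsym' : (T * u * Tᵀ)ᵀ = T * u * Tᵀ := by
    rw [Matrix.transpose_mul, Matrix.transpose_mul, Matrix.transpose_transpose, hsym,
      Matrix.mul_assoc]
  have h0 := apply_zero_zero_eq_zero_of_translate h hu' hsym'
  have hTt : Tᵀ = Matrix.transvection j 0 1 := by
    rw [hT, Matrix.transvection, Matrix.transvection, Matrix.transpose_add, Matrix.transpose_one,
      Matrix.transpose_single]
  have hji : u j 0 = u 0 j := by rw [← Matrix.transpose_apply u 0 j, hsym]
  rw [hTt, Matrix.mul_transvection_apply_same, hT, Matrix.transvection_mul_apply_same,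
    Matrix.transvection_mul_apply_same, hdiag 0, hdiag j, one_mul, one_mul, zero_add, mul_zero,
    add_zero, hji, ← two_mul, mul_eq_zero] at h0
  exact h0.resolve_left two_ne_zero

/-- **`Z(P_Λ)` is not a cone** (LMR 2013, proof of Prop. 3.5.1, p. 481: "the zero set is not a
cone (i.e., the equation involves all the variables)"), typed invariantly under linear changes of
coordinates, for every odd size `2h + 1` (for `h = 0`, `P_Λ = det_1 = X₀₀`): a direction
`u ∈ M_n(ℂ)` with `P_Λ(M + su) = P_Λ(M)` for all `M, s` is zero. PROVED (the print gives no
argument; ours is recorded in the module docstring).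
[cite: LandsbergManivelRessayre2013, Proposition 3.5.1, proof (p. 481)] -/
theorem pLambda_not_cone_aux {u : Matrix (Fin (h + h + 1)) (Fin (h + h + 1)) ℂ}
    (hu : ∀ (M : Matrix (Fin (h + h + 1)) (Fin (h + h + 1)) ℂ) (s : ℂ),
      eval (fun p : Fin (h + h + 1) × Fin (h + h + 1) => (M + s • u) p.1 p.2) (pLambda (h + h + 1)) =
        eval (fun p : Fin (h + h + 1) × Fin (h + h + 1) => M p.1 p.2) (pLambda (h + h + 1))) :
    u = 0 := by
  have hsym := transpose_eq_self_of_translate h hu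
  ext i j
  set σ : Equiv.Perm (Fin (h + h + 1)) := Equiv.swap 0 i with hσ
  have hu' := pLambda_translate_conj hu (isUnit_det_permMatrix σ)
  have hsym' : (σ.permMatrix ℂ * u * (σ.permMatrix ℂ)ᵀ)ᵀ =
      σ.permMatrix ℂ * u * (σ.permMatrix ℂ)ᵀ := by
    rw [Matrix.transpose_mul, Matrix.transpose_mul, Matrix.transpose_transpose, hsym,
      Matrix.mul_assoc]
  have h0 := apply_zero_eq_zero_of_translate h hu' hsym' (σ j)
  rw [permMatrix_mul_mul_transpose_apply, hσ, Equiv.swap_apply_left, Equiv.swap_apply_self] at h0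
  rw [Matrix.zero_apply]
  exact h0

end Cone

/-! ### `End(W)·f = GL(W)·f ∪ cones`: singular substitutions give cones -/

section Singular

variable {σ : Type*} [Fintype σ]

/-- Evaluation rule for linear substitution, `(A · f)(x) = f(l ↦ ∑_j A_{jl} x_j)`, for points with
coordinates in any commutative `ℂ`-algebra. [folklore] -/
private theorem aeval_linSubst_eq {R : Type*} [CommRing R] [Algebra ℂ R] (A : Matrix σ σ ℂ)
    (f : MvPolynomial σ ℂ) (x : σ → R) :
    aeval x (linSubst σ ℂ A f) = aeval (fun l => ∑ j, A j l • x j) f := by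
  rw [linSubst, ← AlgHom.comp_apply, MvPolynomial.comp_aeval]
  have hfun : (fun i => aeval x (∑ j, A j i • X j : MvPolynomial σ ℂ)) = fun l => ∑ j, A j l • x j := by
    funext l
    simp [map_sum]
  rw [hfun]

/-- Evaluation rule for linear substitution at complex points. [folklore] -/
private theorem eval_linSubst_point (A : Matrix σ σ ℂ) (f : MvPolynomial σ ℂ) (x : σ → ℂ) :
    eval x (linSubst σ ℂ A f) = eval (fun l => ∑ j, A j l * x j) f := by
  have h := aeval_linSubst_eq (R := ℂ) A f x
  simpa only [MvPolynomial.aeval_eq_eval, smul_eq_mul] using h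

variable (h : ℕ)

/-- **`P_Λ ∉ (End(W) ∖ GL(W))·f` for any form `f`** ("`End(W)·det_n` consists of `GL(W)·det_n` plus
cones", LMR 2013 p. 481, arXiv `p0008.txt:L96–97`): a substitution by a SINGULAR matrix `B` produces a
form that is translation invariant along a kernel vector of `Bᵀ`, which `P_Λ` is not
(`pLambda_not_cone_aux`). [cite: LandsbergManivelRessayre2013, Proposition 3.5.1, proof (p. 481)] -/
theorem pLambda_ne_linSubst_of_det_eq_zero (f : MvPolynomial (Fin (h + h + 1) × Fin (h + h + 1)) ℂ)
    {B : Matrix (Fin (h + h + 1) × Fin (h + h + 1)) (Fin (h + h + 1) × Fin (h + h + 1)) ℂ}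
    (hB : B.det = 0) : pLambda (h + h + 1) ≠ linSubst _ ℂ B f := by
  classical
  intro heq
  obtain ⟨u, hu0, huB⟩ := Matrix.exists_vecMul_eq_zero_iff.mpr hB
  set U : Matrix (Fin (h + h + 1)) (Fin (h + h + 1)) ℂ := Matrix.of fun a b => u (a, b) with hU
  have hcone : ∀ (M : Matrix (Fin (h + h + 1)) (Fin (h + h + 1)) ℂ) (s : ℂ),
      eval (fun p : Fin (h + h + 1) × Fin (h + h + 1) => (M + s • U) p.1 p.2) (pLambda (h + h + 1)) =
        eval (fun p : Fin (h + h + 1) × Fin (h + h + 1) => M p.1 p.2) (pLambda (h + h + 1)) := by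
    intro M s
    rw [heq, eval_linSubst_point, eval_linSubst_point]
    suffices hpt : (fun l => ∑ j : Fin (h + h + 1) × Fin (h + h + 1), B j l * (M + s • U) j.1 j.2) =
        fun l => ∑ j : Fin (h + h + 1) × Fin (h + h + 1), B j l * M j.1 j.2 by rw [hpt]
    funext l
    have hl : ∑ j : Fin (h + h + 1) × Fin (h + h + 1), B j l * u j = 0 := by
      have := congr_fun huB l
      rw [Matrix.vecMul, dotProduct] at this
      simpa [mul_comm] using this
    simp only [Matrix.add_apply, Matrix.smul_apply, hU, Matrix.of_apply, smul_eq_mul, mul_add,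
      Finset.sum_add_distrib]
    rw [show ∑ j : Fin (h + h + 1) × Fin (h + h + 1), B j l * (s * u (j.1, j.2)) =
        s * ∑ j : Fin (h + h + 1) × Fin (h + h + 1), B j l * u j by
      rw [Finset.mul_sum]; exact Finset.sum_congr rfl fun j _ => by ring, hl, mul_zero, add_zero]
  have hU0 := pLambda_not_cone_aux h hcone
  apply hu0
  funext p
  have := congr_fun (congr_fun hU0 p.1) p.2
  simpa [hU] using this

end Singular

/-! ### `P_Λ` is flat to order `n − 1` along `Sym_n`; `det_n` is so only along rank `≤ 1` -/

section Flat

variable {n : ℕ}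

/-- The generic determinant evaluated at a point: `det_n(x) = det (x_{ij})`. [folklore] -/
private theorem aeval_detPoly {R : Type*} [CommRing R] [Algebra ℂ R] (x : Fin n × Fin n → R) :
    aeval x (detPoly (Fin n) ℂ) = (Matrix.of fun i j => x (i, j)).det := by
  rw [detPoly, AlgHom.map_det, AlgHom.mapMatrix_apply]
  congr 1
  ext i j
  simp [Matrix.mvPolynomialX_apply]

/-- **Flatness of `P_Λ` along `Sym_n`**: for `V` symmetric and any `W`, the one-variable polynomial
`t ↦ P_Λ(V + tW)` is divisible by `t^{n−1}` (the skew part of `V + tW` is `t · (W − Wᵀ)/2` and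
`adj(tA) = t^{n−1} adj(A)`). [folklore] -/
private theorem X_pow_dvd_aeval_pLambda_sym_add {V : Matrix (Fin n) (Fin n) ℂ} (hV : Vᵀ = V)
    (W : Matrix (Fin n) (Fin n) ℂ) :
    (Polynomial.X : Polynomial ℂ) ^ (n - 1) ∣
      aeval (fun p : Fin n × Fin n =>
        (V.map Polynomial.C + (Polynomial.X : Polynomial ℂ) • W.map Polynomial.C) p.1 p.2)
        (pLambda n) := by
  rw [aeval_pLambda]
  set A : Matrix (Fin n) (Fin n) (Polynomial ℂ) := ((1 / 2 : ℂ) • (W - Wᵀ)).map Polynomial.C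
    with hA
  have hskew : (1 / 2 : ℂ) • (V.map Polynomial.C + (Polynomial.X : Polynomial ℂ) • W.map Polynomial.C
      - (V.map Polynomial.C + (Polynomial.X : Polynomial ℂ) • W.map Polynomial.C)ᵀ) =
      (Polynomial.X : Polynomial ℂ) • A := by
    rw [Matrix.transpose_add, Matrix.transpose_smul, ← Matrix.transpose_map, ← Matrix.transpose_map,
      hV]
    ext i j
    simp only [hA, Matrix.smul_apply, Matrix.sub_apply, Matrix.add_apply, Matrix.map_apply,
      Matrix.transpose_apply, smul_eq_mul, Polynomial.smul_eq_C_mul, map_mul, map_sub]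
    ring
  rw [hskew, Matrix.adjugate_smul, Fintype.card_fin, Matrix.smul_mul, Matrix.trace_smul,
    smul_eq_mul, ← mul_smul_comm]
  exact Dvd.intro _ rfl

/-- The linear map `V ↦ (x ↦ ∑_j G_{j x} V_j)` on `n × n` matrices induced by a substitution matrix
`G` on `W = M_n(ℂ)` (the transpose action of `linSubst`: `(G · f)(V) = f(linImage G V)`). An explicit
auxiliary map; not a notion of the source. [folklore] -/
def linImage (G : Matrix (Fin n × Fin n) (Fin n × Fin n) ℂ) (V : Matrix (Fin n) (Fin n) ℂ) :
    Matrix (Fin n) (Fin n) ℂ :=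
  Matrix.of fun a b => ((fun p : Fin n × Fin n => V p.1 p.2) ᵥ* G) (a, b)

/-- Entries of `linImage G V`. [folklore] -/
private theorem linImage_apply (G : Matrix (Fin n × Fin n) (Fin n × Fin n) ℂ) (V : Matrix (Fin n) (Fin n) ℂ)
    (a b : Fin n) : linImage G V a b = ∑ j : Fin n × Fin n, V j.1 j.2 * G j (a, b) := by
  simp [linImage, Matrix.vecMul, dotProduct]

/-- `linImage` is compatible with products: `linImage H (linImage G V) = linImage (G * H) V`. [folklore] -/
private theorem linImage_linImage (G H : Matrix (Fin n × Fin n) (Fin n × Fin n) ℂ)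
    (V : Matrix (Fin n) (Fin n) ℂ) : linImage H (linImage G V) = linImage (G * H) V := by
  unfold linImage
  rw [← Matrix.vecMul_vecMul]
  rfl

/-- `linImage 1 = id`. [folklore] -/
private theorem linImage_one (V : Matrix (Fin n) (Fin n) ℂ) : linImage 1 V = V := by
  ext a b
  simp [linImage]

/-- `linImage G` is additive. [folklore] -/
private theorem linImage_add (G : Matrix (Fin n × Fin n) (Fin n × Fin n) ℂ) (V V' : Matrix (Fin n) (Fin n) ℂ) :
    linImage G (V + V') = linImage G V + linImage G V' := by
  ext a b
  simp only [linImage_apply, Matrix.add_apply, add_mul, Finset.sum_add_distrib]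

/-- `linImage G` is homogeneous. [folklore] -/
private theorem linImage_smul (G : Matrix (Fin n × Fin n) (Fin n × Fin n) ℂ) (c : ℂ)
    (V : Matrix (Fin n) (Fin n) ℂ) : linImage G (c • V) = c • linImage G V := by
  ext a b
  simp only [linImage_apply, Matrix.smul_apply, smul_eq_mul, mul_assoc, Finset.mul_sum]

/-- `linImage G 0 = 0`. [folklore] -/
private theorem linImage_zero (G : Matrix (Fin n × Fin n) (Fin n × Fin n) ℂ) : linImage G 0 = 0 := by
  ext a b
  simp [linImage_apply]

/-- For invertible `G`, `linImage G⁻¹` inverts `linImage G`. [folklore] -/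
private theorem linImage_inv_linImage {G : Matrix (Fin n × Fin n) (Fin n × Fin n) ℂ} (hG : IsUnit G.det)
    (V : Matrix (Fin n) (Fin n) ℂ) : linImage G⁻¹ (linImage G V) = V := by
  rw [linImage_linImage, Matrix.mul_nonsing_inv _ hG, linImage_one]

/-- For invertible `G`, `linImage G` inverts `linImage G⁻¹`. [folklore] -/
private theorem linImage_linImage_inv {G : Matrix (Fin n × Fin n) (Fin n × Fin n) ℂ} (hG : IsUnit G.det)
    (V : Matrix (Fin n) (Fin n) ℂ) : linImage G (linImage G⁻¹ V) = V := by
  rw [linImage_linImage, Matrix.nonsing_inv_mul _ hG, linImage_one]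

/-- **The substituted determinant along a line**: `(G · det_n)(V + tW) = det(linImage G V + t · linImage G W)`
as polynomials in `t`. [folklore] -/
private theorem aeval_linSubst_detPoly_line (G : Matrix (Fin n × Fin n) (Fin n × Fin n) ℂ)
    (V W : Matrix (Fin n) (Fin n) ℂ) :
    aeval (fun p : Fin n × Fin n =>
        (V.map Polynomial.C + (Polynomial.X : Polynomial ℂ) • W.map Polynomial.C) p.1 p.2)
      (linSubst _ ℂ G (detPoly (Fin n) ℂ)) =
      ((linImage G V).map Polynomial.C +
        (Polynomial.X : Polynomial ℂ) • (linImage G W).map Polynomial.C).det := by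
  rw [aeval_linSubst_eq, aeval_detPoly]
  congr 1
  funext a b
  simp only [Matrix.of_apply, Matrix.add_apply, Matrix.map_apply, Matrix.smul_apply, smul_eq_mul,
    linImage_apply, Polynomial.smul_eq_C_mul, map_sum, map_mul, Finset.mul_sum,
    ← Finset.sum_add_distrib]
  exact Finset.sum_congr rfl fun j _ => by ring

/-- **Order of vanishing of `det_n` detects rank `≤ 1`**: if `t^{n−1}` divides `det(Z + tY)` for
EVERY `Y`, then `Z = x ⊗ y` is of rank at most one. Proof: bring `Z` to diagonal form `D` by
transvections on both sides (Mathlib `Matrix.Pivot.exists_list_transvec_mul_mul_list_transvec_eq_diagonal`);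
testing with `Y` = a partial identity shows `D_i D_k = 0` for `i ≠ k`. [folklore] -/
private theorem exists_eq_vecMulVec_of_X_pow_dvd_det [NeZero n] {Z : Matrix (Fin n) (Fin n) ℂ}
    (hZ : ∀ Y : Matrix (Fin n) (Fin n) ℂ, (Polynomial.X : Polynomial ℂ) ^ (n - 1) ∣
      (Z.map Polynomial.C + (Polynomial.X : Polynomial ℂ) • Y.map Polynomial.C).det) :
    ∃ x y : Fin n → ℂ, Z = Matrix.vecMulVec x y := by
  classical
  obtain ⟨L, L', D, hD⟩ := Matrix.Pivot.exists_list_transvec_mul_mul_list_transvec_eq_diagonal Z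
  set P : Matrix (Fin n) (Fin n) ℂ := (L.map Matrix.TransvectionStruct.toMatrix).prod with hP
  set Q : Matrix (Fin n) (Fin n) ℂ := (L'.map Matrix.TransvectionStruct.toMatrix).prod with hQ
  have hPdet : P.det = 1 := by rw [hP, Matrix.TransvectionStruct.det_toMatrix_prod]
  have hQdet : Q.det = 1 := by rw [hQ, Matrix.TransvectionStruct.det_toMatrix_prod]
  have hPu : IsUnit P.det := by rw [hPdet]; exact isUnit_one
  have hQu : IsUnit Q.det := by rw [hQdet]; exact isUnit_one
  -- the divisibility transfers to the diagonal form
  have hdiag : ∀ Y₀ : Matrix (Fin n) (Fin n) ℂ, (Polynomial.X : Polynomial ℂ) ^ (n - 1) ∣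
      ((Matrix.diagonal D).map Polynomial.C +
        (Polynomial.X : Polynomial ℂ) • Y₀.map Polynomial.C).det := by
    intro Y₀
    have h1 := hZ (P⁻¹ * Y₀ * Q⁻¹)
    have hmat : (P.map Polynomial.C) *
        (Z.map Polynomial.C + (Polynomial.X : Polynomial ℂ) • (P⁻¹ * Y₀ * Q⁻¹).map Polynomial.C) *
        (Q.map Polynomial.C) =
        (Matrix.diagonal D).map Polynomial.C + (Polynomial.X : Polynomial ℂ) • Y₀.map Polynomial.C := by
      rw [Matrix.mul_add, Matrix.add_mul, Matrix.mul_smul, Matrix.smul_mul, ← Matrix.map_mul,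
        ← Matrix.map_mul, ← Matrix.map_mul, ← Matrix.map_mul, hD]
      congr 2
      rw [show P * (P⁻¹ * Y₀ * Q⁻¹) * Q = (P * P⁻¹) * Y₀ * (Q⁻¹ * Q) by
        simp only [Matrix.mul_assoc], Matrix.mul_nonsing_inv _ hPu, Matrix.nonsing_inv_mul _ hQu,
        Matrix.one_mul, Matrix.mul_one]
    have hPC : (P.map (Polynomial.C : ℂ →+* Polynomial ℂ)).det = 1 := by
      rw [← RingHom.mapMatrix_apply, ← RingHom.map_det, hPdet, map_one]
    have hQC : (Q.map (Polynomial.C : ℂ →+* Polynomial ℂ)).det = 1 := by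
      rw [← RingHom.mapMatrix_apply, ← RingHom.map_det, hQdet, map_one]
    rw [← hmat, Matrix.det_mul, Matrix.det_mul, hPC, hQC, mul_one, one_mul]
    exact h1
  -- `D i * D k = 0` for `i ≠ k`
  have hDD : ∀ i k : Fin n, i ≠ k → D i * D k = 0 := by
    intro i k hik
    have hn2 : 2 ≤ n := by
      have := Fintype.one_lt_card_iff.mpr ⟨i, k, hik⟩
      rwa [Fintype.card_fin] at this
    set y₀ : Fin n → ℂ := fun r => if r = i ∨ r = k then 0 else 1 with hy₀
    have h1 := hdiag (Matrix.diagonal y₀)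
    have hdet : ((Matrix.diagonal D).map Polynomial.C +
        (Polynomial.X : Polynomial ℂ) • (Matrix.diagonal y₀).map Polynomial.C).det =
        Polynomial.C (D i * D k) *
          ∏ r ∈ ({i, k} : Finset (Fin n))ᶜ, (Polynomial.X + Polynomial.C (D r)) := by
      rw [Matrix.diagonal_map (Polynomial.C_0), Matrix.diagonal_map (Polynomial.C_0),
        ← Matrix.diagonal_smul, Matrix.diagonal_add, Matrix.det_diagonal,
        ← Finset.prod_mul_prod_compl ({i, k} : Finset (Fin n)), Finset.prod_pair hik]
      congr 1
      · simp only [Pi.smul_apply, hy₀, true_or, or_true, if_true, map_zero, smul_zero, add_zero,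
          map_mul]
      · refine Finset.prod_congr rfl fun r hr => ?_
        rw [Finset.mem_compl, Finset.mem_insert, Finset.mem_singleton, not_or] at hr
        simp only [Pi.smul_apply, hy₀, hr.1, hr.2, or_self, if_false, map_one, smul_eq_mul, mul_one]
        ring
    have hmonic : (∏ r ∈ ({i, k} : Finset (Fin n))ᶜ, (Polynomial.X + Polynomial.C (D r))).Monic :=
      Polynomial.monic_prod_of_monic _ _ fun r _ => Polynomial.monic_X_add_C (D r)
    have hdeg : (∏ r ∈ ({i, k} : Finset (Fin n))ᶜ, (Polynomial.X + Polynomial.C (D r))).natDegree =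
        n - 2 := by
      rw [Polynomial.natDegree_prod_of_monic _ _ fun r _ => Polynomial.monic_X_add_C (D r)]
      simp only [Polynomial.natDegree_X_add_C, Finset.sum_const, smul_eq_mul, mul_one,
        Finset.card_compl, Finset.card_pair hik, Fintype.card_fin]
    rw [hdet] at h1
    obtain ⟨q, hq⟩ := h1
    have hcoeff := congrArg (fun f : Polynomial ℂ => f.coeff (n - 2)) hq
    simp only [Polynomial.coeff_C_mul, Polynomial.coeff_X_pow_mul'] at hcoeff
    rw [← hdeg, hmonic.coeff_natDegree, mul_one, hdeg, if_neg (by omega)] at hcoeff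
    exact hcoeff
  -- hence the diagonal form has rank ≤ 1
  have hDvec : ∃ x y : Fin n → ℂ, Matrix.diagonal D = Matrix.vecMulVec x y := by
    by_cases hex : ∃ i₀, D i₀ ≠ 0
    swap
    · have hall : ∀ r, D r = 0 := fun r => by
        by_contra hr
        exact hex ⟨r, hr⟩
      refine ⟨0, 0, ?_⟩
      rw [Matrix.zero_vecMulVec]
      ext a b
      simp [Matrix.diagonal_apply, hall]
    · obtain ⟨i₀, hi₀⟩ := hex
      refine ⟨Pi.single i₀ (D i₀), Pi.single i₀ 1, ?_⟩
      ext a b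
      rw [Matrix.vecMulVec_apply, Matrix.diagonal_apply]
      by_cases hab : a = b
      · subst hab
        by_cases ha : a = i₀
        · subst ha; simp
        · have := hDD i₀ a (Ne.symm ha)
          rw [if_pos rfl, Pi.single_eq_of_ne ha, zero_mul]
          exact (mul_eq_zero.mp this).resolve_left hi₀
      · rw [if_neg hab]
        by_cases ha : a = i₀
        · subst ha
          rw [Pi.single_eq_of_ne (Ne.symm hab), mul_zero]
        · rw [Pi.single_eq_of_ne ha, zero_mul]
  obtain ⟨x, y, hxy⟩ := hDvec
  refine ⟨P⁻¹ *ᵥ x, y ᵥ* Q⁻¹, ?_⟩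
  have hZ' : Z = P⁻¹ * (P * Z * Q) * Q⁻¹ := by
    rw [show P⁻¹ * (P * Z * Q) * Q⁻¹ = (P⁻¹ * P) * Z * (Q * Q⁻¹) by simp only [Matrix.mul_assoc],
      Matrix.nonsing_inv_mul _ hPu, Matrix.mul_nonsing_inv _ hQu, Matrix.one_mul, Matrix.mul_one]
  rw [hZ', hD, hxy, Matrix.mul_vecMulVec, Matrix.vecMulVec_mul]

end Flat

/-! ### A linear space of matrices of rank `≤ 1` is small -/

section Counting

variable {n : ℕ}

/-- Two nonzero proportionality-free rank-one matrices sum to rank two: if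
`x ⊗ y + x' ⊗ y' = p ⊗ q` with `x, y ≠ 0`, then `x' ∥ x` or `y' ∥ y`. [folklore] -/
private theorem smul_or_smul_of_vecMulVec_add_vecMulVec {x y x' y' p q : Fin n → ℂ} (hx : x ≠ 0) (hy : y ≠ 0)
    (hsum : Matrix.vecMulVec x y + Matrix.vecMulVec x' y' = Matrix.vecMulVec p q) :
    (∃ c : ℂ, x' = c • x) ∨ (∃ c : ℂ, y' = c • y) := by
  by_contra hcon
  rw [not_or, not_exists, not_exists] at hcon
  obtain ⟨hx', hy'⟩ := hcon
  obtain ⟨b, hb⟩ := Function.ne_iff.mp hy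
  have hb' : y b ≠ 0 := by simpa using hb
  -- a nonvanishing `2 × 2` minor of `(y, y')`
  have hminor : ∃ j l, y j * y' l - y l * y' j ≠ 0 := by
    by_contra hall
    rw [not_exists] at hall
    apply hy' (y' b / y b)
    funext l
    have h1 : y b * y' l - y l * y' b = 0 := by
      by_contra hne
      exact hall b ⟨l, hne⟩
    rw [Pi.smul_apply, smul_eq_mul, div_mul_eq_mul_div, eq_div_iff hb']
    linear_combination h1
  obtain ⟨j, l, hδ⟩ := hminor
  have hent : ∀ i k, x i * y k + x' i * y' k = p i * q k := fun i k => by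
    have := congr_fun (congr_fun hsum i) k
    simpa [Matrix.add_apply, Matrix.vecMulVec_apply] using this
  -- solve the `2 × 2` systems for `x i` and `x' i`
  have hxi : ∀ i, x i * (y j * y' l - y l * y' j) = p i * (q j * y' l - q l * y' j) := fun i => by
    linear_combination (y' l) * hent i j - (y' j) * hent i l
  have hx'i : ∀ i, x' i * (y j * y' l - y l * y' j) = p i * (q l * y j - q j * y l) := fun i => by
    linear_combination (y j) * hent i l - (y l) * hent i j
  set δ := y j * y' l - y l * y' j with hδ_def
  set c₂ := q j * y' l - q l * y' j with hc₂
  set c₁ := q l * y j - q j * y l with hc₁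
  have hc₂0 : c₂ ≠ 0 := by
    intro h0
    apply hx
    funext i
    have := hxi i
    rw [h0, mul_zero, mul_eq_zero] at this
    exact this.resolve_right hδ
  apply hx' (c₁ / c₂)
  funext i
  rw [Pi.smul_apply, smul_eq_mul]
  have h1 := hxi i
  have h2 := hx'i i
  field_simp
  -- `x' i * c₂ = c₁ * x i`: multiply by `δ ≠ 0`
  have : (x' i * c₂ - c₁ * x i) * δ = 0 := by linear_combination c₂ * h2 - c₁ * h1
  have h3 := (mul_eq_zero.mp this).resolve_right hδ
  linear_combination h3

/-- **Dichotomy for a linear family of rank `≤ 1` matrices.** If every symmetric `V` is mapped by the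
invertible linear map `linImage G` to a matrix of rank `≤ 1`, then all these images share a column
vector `x₀` or all share a row vector `y₀` (a vector space inside the union of two subspaces lies in
one of them). [folklore] -/
private theorem linImage_sym_subset_row_or_col [NeZero n] {G : Matrix (Fin n × Fin n) (Fin n × Fin n) ℂ}
    (hG : IsUnit G.det)
    (hrank : ∀ V : Matrix (Fin n) (Fin n) ℂ, Vᵀ = V → ∃ x y : Fin n → ℂ, linImage G V = Matrix.vecMulVec x y) :
    ∃ x₀ y₀ : Fin n → ℂ, x₀ ≠ 0 ∧ y₀ ≠ 0 ∧
      ((∀ V : Matrix (Fin n) (Fin n) ℂ, Vᵀ = V → ∃ z, linImage G V = Matrix.vecMulVec x₀ z) ∨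
        (∀ V : Matrix (Fin n) (Fin n) ℂ, Vᵀ = V → ∃ z, linImage G V = Matrix.vecMulVec z y₀)) := by
  set V₁ : Matrix (Fin n) (Fin n) ℂ := Matrix.single 0 0 1 with hV₁
  have hV₁sym : V₁ᵀ = V₁ := by rw [hV₁, Matrix.transpose_single]
  obtain ⟨x₀, y₀, h₁⟩ := hrank V₁ hV₁sym
  have hne : linImage G V₁ ≠ 0 := by
    intro h0
    have := linImage_inv_linImage hG V₁
    rw [h0, linImage_zero] at this
    have h00 := congr_fun (congr_fun this 0) 0
    rw [hV₁, Matrix.zero_apply, Matrix.single_apply_same] at h00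
    exact one_ne_zero h00.symm
  rw [h₁] at hne
  have hx₀ : x₀ ≠ 0 := fun h0 => hne (by rw [h0, Matrix.zero_vecMulVec])
  have hy₀ : y₀ ≠ 0 := fun h0 => hne (by rw [h0, Matrix.vecMulVec_zero])
  refine ⟨x₀, y₀, hx₀, hy₀, ?_⟩
  -- local dichotomy
  have hloc : ∀ V : Matrix (Fin n) (Fin n) ℂ, Vᵀ = V →
      (∃ z, linImage G V = Matrix.vecMulVec x₀ z) ∨ (∃ z, linImage G V = Matrix.vecMulVec z y₀) := by
    intro V hV
    obtain ⟨x', y', h'⟩ := hrank V hV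
    obtain ⟨p, q, hpq⟩ := hrank (V₁ + V) (by rw [Matrix.transpose_add, hV₁sym, hV])
    rw [linImage_add, h₁, h'] at hpq
    rcases smul_or_smul_of_vecMulVec_add_vecMulVec hx₀ hy₀ hpq with ⟨c, hc⟩ | ⟨c, hc⟩
    · left
      refine ⟨c • y', ?_⟩
      rw [h', hc, Matrix.smul_vecMulVec, Matrix.vecMulVec_smul]
    · right
      refine ⟨c • x', ?_⟩
      rw [h', hc, Matrix.smul_vecMulVec, Matrix.vecMulVec_smul]
  -- global dichotomy
  by_contra hcon
  rw [not_or, not_forall, not_forall] at hcon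
  obtain ⟨⟨Va, hVa⟩, ⟨Vb, hVb⟩⟩ := hcon
  rw [Classical.not_imp] at hVa hVb
  obtain ⟨hVasym, hVa⟩ := hVa
  obtain ⟨hVbsym, hVb⟩ := hVb
  obtain ⟨za, hza⟩ := (hloc Va hVasym).resolve_left hVa
  obtain ⟨zb, hzb⟩ := (hloc Vb hVbsym).resolve_right hVb
  rcases hloc (Va + Vb) (by rw [Matrix.transpose_add, hVasym, hVbsym]) with ⟨w, hw⟩ | ⟨w, hw⟩
  · apply hVa
    refine ⟨w - zb, ?_⟩
    rw [linImage_add, hzb] at hw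
    rw [Matrix.vecMulVec_sub, ← hw, add_sub_cancel_right]
  · apply hVb
    refine ⟨w - za, ?_⟩
    rw [linImage_add, hza] at hw
    rw [Matrix.sub_vecMulVec, ← hw, add_sub_cancel_left]

/-- **Counting**: no `ℂ`-linear map `Λ : M_n(ℂ) → ℂⁿ` is injective on the symmetric matrices when
`n ≥ 2` (the `n + 1` symmetric matrices `E_{rr}`, `E_{01} + E_{10}` would have independent images in
`ℂⁿ`). [folklore] -/
private theorem not_injOn_sym_of_linearMap (hn : 2 ≤ n) (Λ : Matrix (Fin n) (Fin n) ℂ →ₗ[ℂ] (Fin n → ℂ))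
    (hinj : ∀ V : Matrix (Fin n) (Fin n) ℂ, Vᵀ = V → Λ V = 0 → V = 0) : False := by
  set i0 : Fin n := ⟨0, by omega⟩ with hi0
  set i1 : Fin n := ⟨1, by omega⟩ with hi1
  have h01 : i0 ≠ i1 := by rw [hi0, hi1]; exact fun h => by simpa using congrArg Fin.val h
  set e : Option (Fin n) → Matrix (Fin n) (Fin n) ℂ := fun o => match o with
    | none => Matrix.single i0 i1 1 + Matrix.single i1 i0 1
    | some r => Matrix.single r r 1
    with he
  have hli : ¬ LinearIndependent ℂ (fun o => Λ (e o)) := by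
    intro hli
    have := hli.fintype_card_le_finrank
    rw [Fintype.card_option, Fintype.card_fin, Module.finrank_fin_fun] at this
    omega
  obtain ⟨g, hg, o, ho⟩ := Fintype.not_linearIndependent_iff.mp hli
  set V : Matrix (Fin n) (Fin n) ℂ := ∑ o, g o • e o with hV
  have hΛV : Λ V = 0 := by
    rw [hV, map_sum]
    simpa only [map_smul] using hg
  have hesym : ∀ o, (e o)ᵀ = e o := by
    rintro (_ | r)
    · simp only [he, Matrix.transpose_add, Matrix.transpose_single, add_comm]
    · simp only [he, Matrix.transpose_single]
  have hVsym : Vᵀ = V := by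
    rw [hV, Matrix.transpose_sum]
    exact Finset.sum_congr rfl fun o _ => by rw [Matrix.transpose_smul, hesym]
  have hV0 := hinj V hVsym hΛV
  -- read off the coefficients
  have hVeq : V = g none • (Matrix.single i0 i1 1 + Matrix.single i1 i0 1) +
      Matrix.diagonal (fun r => g (some r)) := by
    rw [hV, Fintype.sum_option, ← Matrix.sum_single_eq_diagonal]
    congr 1
    exact Finset.sum_congr rfl fun r _ => by
      simp only [he, Matrix.smul_single, smul_eq_mul, mul_one]
  have e1 : ∀ r : Fin n, Matrix.single i0 i1 (1 : ℂ) r r = 0 := fun r =>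
    Matrix.single_apply_of_ne i0 i1 (1 : ℂ) r r fun hh => h01 (hh.1.trans hh.2.symm)
  have e2 : ∀ r : Fin n, Matrix.single i1 i0 (1 : ℂ) r r = 0 := fun r =>
    Matrix.single_apply_of_ne i1 i0 (1 : ℂ) r r fun hh => h01 (hh.2.trans hh.1.symm)
  have e3 : Matrix.single i1 i0 (1 : ℂ) i0 i1 = 0 :=
    Matrix.single_apply_of_ne i1 i0 (1 : ℂ) i0 i1 fun hh => h01 hh.2
  have hdiag : ∀ r : Fin n, g (some r) = 0 := by
    intro r
    have := congr_fun (congr_fun hV0 r) r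
    rwa [hVeq, Matrix.add_apply, Matrix.smul_apply, Matrix.add_apply, e1, e2, add_zero, smul_zero,
      zero_add, Matrix.diagonal_apply_eq, Matrix.zero_apply] at this
  have hnone : g none = 0 := by
    have := congr_fun (congr_fun hV0 i0) i1
    rwa [hVeq, Matrix.add_apply, Matrix.smul_apply, Matrix.add_apply, Matrix.single_apply_same, e3,
      add_zero, smul_eq_mul, mul_one, Matrix.diagonal_apply_ne _ h01, add_zero, Matrix.zero_apply]
      at this
  apply ho
  cases o with
  | none => exact hnone
  | some r => exact hdiag r

/-- **Linear spaces of rank `≤ 1` matrices are too small to contain the image of `Sym_n`** (`n ≥ 2`):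
an invertible `linImage G` cannot map every symmetric matrix to a matrix of rank `≤ 1`. [folklore] -/
private theorem not_linImage_sym_rank_le_one [NeZero n] (hn : 2 ≤ n)
    {G : Matrix (Fin n × Fin n) (Fin n × Fin n) ℂ} (hG : IsUnit G.det)
    (hrank : ∀ V : Matrix (Fin n) (Fin n) ℂ, Vᵀ = V → ∃ x y : Fin n → ℂ, linImage G V = Matrix.vecMulVec x y) :
    False := by
  obtain ⟨x₀, y₀, hx₀, hy₀, hdich⟩ := linImage_sym_subset_row_or_col hG hrank
  have hinj0 : ∀ V : Matrix (Fin n) (Fin n) ℂ, linImage G V = 0 → V = 0 := fun V hV => by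
    rw [← linImage_inv_linImage hG V, hV, linImage_zero]
  rcases hdich with hrow | hcol
  · obtain ⟨a, ha⟩ := Function.ne_iff.mp hx₀
    refine not_injOn_sym_of_linearMap hn
      { toFun := fun V => fun c => linImage G V a c
        map_add' := fun V V' => by funext c; rw [linImage_add]; rfl
        map_smul' := fun s V => by funext c; rw [linImage_smul]; rfl } fun V hV hΛ => ?_
    obtain ⟨z, hz⟩ := hrow V hV
    have hz0 : z = 0 := by
      funext c
      have := congr_fun hΛ c
      simp only [LinearMap.coe_mk, AddHom.coe_mk, hz, Matrix.vecMulVec_apply, Pi.zero_apply,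
        mul_eq_zero] at this
      exact this.resolve_left ha
    exact hinj0 V (by rw [hz, hz0, Matrix.vecMulVec_zero])
  · obtain ⟨b, hb⟩ := Function.ne_iff.mp hy₀
    refine not_injOn_sym_of_linearMap hn
      { toFun := fun V => fun r => linImage G V r b
        map_add' := fun V V' => by funext r; rw [linImage_add]; rfl
        map_smul' := fun s V => by funext r; rw [linImage_smul]; rfl } fun V hV hΛ => ?_
    obtain ⟨z, hz⟩ := hcol V hV
    have hz0 : z = 0 := by
      funext r
      have := congr_fun hΛ r
      simp only [LinearMap.coe_mk, AddHom.coe_mk, hz, Matrix.vecMulVec_apply, Pi.zero_apply,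
        mul_eq_zero] at this
      exact this.resolve_right hb
    exact hinj0 V (by rw [hz, hz0, Matrix.zero_vecMulVec])

end Counting

/-! ### `P_Λ ∉ GL(W)·det_n`, `P_Λ ∉ End(W)·det_n`, and the consequences for `dc` -/

section Main

/-- **`P_Λ ∉ GL(W)·det_n`** in substitution form: `P_Λ ≠ G · det_n` for every invertible
substitution matrix `G` (odd size `2h+1 ≥ 3`). DEVIATION from the printed stabiliser-dimension
argument (recorded in the module docstring): flatness of `P_Λ` to order `n−1` along `Sym_n` versus
`det_n(Y + tX) = O(t^{n−1}) ∀ X ⇒ rank Y ≤ 1`, and the dimension count `n < n(n+1)/2`.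
[cite: LandsbergManivelRessayre2013, Proposition 3.5.1 (p. 481)] -/
theorem pLambda_ne_linSubst_detPoly_of_isUnit (h : ℕ) (hh : 1 ≤ h)
    {G : Matrix (Fin (h + h + 1) × Fin (h + h + 1)) (Fin (h + h + 1) × Fin (h + h + 1)) ℂ}
    (hG : IsUnit G.det) : pLambda (h + h + 1) ≠ linSubst _ ℂ G (detPoly (Fin (h + h + 1)) ℂ) := by
  intro heq
  refine not_linImage_sym_rank_le_one (n := h + h + 1) (by omega) hG fun V hV => ?_
  refine exists_eq_vecMulVec_of_X_pow_dvd_det fun Y => ?_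
  have hdvd := X_pow_dvd_aeval_pLambda_sym_add hV (linImage G⁻¹ Y)
  rwa [heq, aeval_linSubst_detPoly_line, linImage_linImage_inv hG] at hdvd

variable {n : ℕ}

/-- **`Z(P_Λ)` is not a cone** (LMR 2013, proof of Prop. 3.5.1, p. 481, arXiv `p0008.txt:L96`: "the
zero set is not a cone (i.e., the equation involves all the variables)"), for every odd `n`, typed
invariantly under linear changes of coordinates: a direction `u ∈ M_n(ℂ)` with `P_Λ(M + su) = P_Λ(M)`
for all `M, s` is zero. PROVED. [cite: LandsbergManivelRessayre2013, Proposition 3.5.1, proof (p. 481)] -/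
theorem pLambda_not_cone (hn : Odd n) {u : Matrix (Fin n) (Fin n) ℂ}
    (hu : ∀ (M : Matrix (Fin n) (Fin n) ℂ) (s : ℂ),
      eval (fun p : Fin n × Fin n => (M + s • u) p.1 p.2) (pLambda n) =
        eval (fun p : Fin n × Fin n => M p.1 p.2) (pLambda n)) : u = 0 := by
  obtain ⟨h, rfl⟩ : ∃ h, n = h + h + 1 := by obtain ⟨k, hk⟩ := hn; exact ⟨k, by omega⟩
  exact pLambda_not_cone_aux h hu

/-- **LMR 2013, Prop. 3.5.1: `P_Λ ∉ End(W)·det_n`** (`n` odd, `n ≥ 3`), the pointed form of "not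
contained in `End(W)·[det_n]`": `End(W)·det_n` "consists of `GL(W)·det_n` plus cones"
(`pLambda_ne_linSubst_of_det_eq_zero`) and `P_Λ ∉ GL(W)·det_n` (`pLambda_ne_linSubst_detPoly_of_isUnit`).
[cite: LandsbergManivelRessayre2013, Proposition 3.5.1 (p. 481)] -/
theorem pLambda_not_mem_endOrbit_detPoly (hn : Odd n) (h3 : 3 ≤ n) :
    pLambda n ∉ endOrbit (Fin n × Fin n) ℂ (detPoly (Fin n) ℂ) := by
  obtain ⟨h, rfl⟩ : ∃ h, n = h + h + 1 := by obtain ⟨k, hk⟩ := hn; exact ⟨k, by omega⟩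
  rintro ⟨B, hB⟩
  by_cases hdet : B.det = 0
  · exact pLambda_ne_linSubst_of_det_eq_zero h _ hdet hB.symm
  · exact pLambda_ne_linSubst_detPoly_of_isUnit h (by omega) (isUnit_iff_ne_zero.mpr hdet) hB.symm

/-- Hence **`P_Λ ∉ GL(W)·det_n`** ("[`\overline{GL(W)·P_Λ}`] is not contained in the orbit of the
determinant", LMR 2013 p. 481). [cite: LandsbergManivelRessayre2013, Proposition 3.5.1 (p. 481)] -/
theorem pLambda_not_mem_glOrbit_detPoly (hn : Odd n) (h3 : 3 ≤ n) :
    pLambda n ∉ glOrbit (Fin n × Fin n) ℂ (detPoly (Fin n) ℂ) := fun hmem =>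
  pLambda_not_mem_endOrbit_detPoly hn h3 (glOrbit_subset_endOrbit _ hmem)

/-- **LMR 2013, Prop. 3.5.1, conjunct (d) of the typed `LMR2013_prop_3_5_1`**:
"`\overline{GL(W)·P_Λ}` … [is] not contained in `End(W)·[det_n]`" — PROVED:
`¬ (orbitClosure (pLambda n) ⊆ endOrbit det_n)` (`n` odd, `n ≥ 3`), since already `P_Λ ∉ End(W)·det_n`.
[cite: LandsbergManivelRessayre2013, Proposition 3.5.1 (p. 481)] -/
theorem not_orbitClosure_pLambda_subset_endOrbit (hn : Odd n) (h3 : 3 ≤ n) :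
    ¬ (orbitClosure (pLambda n) ⊆ endOrbit (Fin n × Fin n) ℂ (detPoly (Fin n) ℂ)) := fun hsub =>
  pLambda_not_mem_endOrbit_detPoly hn h3 (hsub (mem_orbitClosure_self _))

/-- `P_Λ` is a form of degree `n` (it lies in the orbit closure of `det_n`, whose points are forms of
degree `n`). [cite: LandsbergManivelRessayre2013, §3.5 (p. 480)] -/
theorem pLambda_isHomogeneous (hn : Odd n) : (pLambda n).IsHomogeneous n := by
  have := (detPoly_isHomogeneous (n := Fin n) (k := ℂ)).of_mem_orbitClosure
    (pLambda_mem_orbitClosure_detPoly hn)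
  rwa [Fintype.card_fin] at this

/-- `P_Λ ≠ 0` in odd size: `P_Λ(A₀ + E₀₀) = det(J)/n ≠ 0` for the witness `A₀`.
[cite: LandsbergManivelRessayre2013, §3.5 (p. 480)] -/
theorem pLambda_ne_zero (hn : Odd n) : pLambda n ≠ 0 := by
  obtain ⟨h, rfl⟩ : ∃ h, n = h + h + 1 := by obtain ⟨k, hk⟩ := hn; exact ⟨k, by omega⟩
  intro h0
  have hE : (Matrix.single (0 : Fin (h + h + 1)) (0 : Fin (h + h + 1)) (1 : ℂ))ᵀ =
      Matrix.single (0 : Fin (h + h + 1)) (0 : Fin (h + h + 1)) (1 : ℂ) := by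
    rw [Matrix.transpose_single]
  have h1 := eval_pLambda_skew_add_sym (S := Matrix.single 0 0 1) (lmrSkewStd_transpose h) hE
  rw [h0, map_zero, adjugate_lmrSkewStd, trace_mul_single, Matrix.single_apply_same, one_mul] at h1
  have hn0 : (1 / ((h + h + 1 : ℕ) : ℂ)) ≠ 0 := one_div_ne_zero (Nat.cast_ne_zero.mpr (by omega))
  exact (mul_ne_zero hn0 (det_lmrSympl_ne_zero h)) h1.symm

/-- `deg P_Λ = n`. [cite: LandsbergManivelRessayre2013, §3.5 (p. 480)] -/
theorem totalDegree_pLambda (hn : Odd n) : (pLambda n).totalDegree = n :=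
  (pLambda_isHomogeneous hn).totalDegree (pLambda_ne_zero hn)

/-- **LMR 2013, Prop. 3.5.1, conjunct (f) of the typed `LMR2013_prop_3_5_1`: `n < dc(P_{Λ,n})`**
(`n` odd, `n ≥ 3`) — PROVED: `dc ≥ deg P_Λ = n` (`totalDegree_le_determinantalComplexity_holds`), and
a size-`n` affine determinantal expression of the degree-`n` form `P_Λ` would place `P_Λ` in
`End(W)·det_n` (Mulmuley–Sohoni 2001 Prop. 4.4, `X_pow_mul_rename_mem_endOrbit_detPoly`), contradicting
`pLambda_not_mem_endOrbit_detPoly`. [cite: LandsbergManivelRessayre2013, Proposition 3.5.1 (p. 481)] -/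
theorem lt_determinantalComplexity_pLambda (hn : Odd n) (h3 : 3 ≤ n) :
    n < determinantalComplexity (pLambda n) := by
  classical
  haveI : NeZero n := ⟨by omega⟩
  have hle : n ≤ determinantalComplexity (pLambda n) := by
    have := totalDegree_le_determinantalComplexity_holds (pLambda n)
    rwa [totalDegree_pLambda hn] at this
  refine lt_of_le_of_ne hle fun heq => ?_
  have hrepr : HasDetRepr (pLambda n) n := by
    have := hasDetRepr_determinantalComplexity_holds (pLambda n)
    rwa [← heq] at this
  have hmem := X_pow_mul_rename_mem_endOrbit_detPoly (pLambda_isHomogeneous hn) le_rfl hrepr id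
    ((0 : Fin n), (0 : Fin n))
  rw [Nat.sub_self, pow_zero, one_mul, MvPolynomial.rename_id_apply] at hmem
  exact pLambda_not_mem_endOrbit_detPoly hn h3 hmem

/-- **LMR 2013, Prop. 3.5.1: `\overline{dc}(P_{Λ,n}) = n < dc(P_{Λ,n})`** (`n` odd, `n ≥ 3`) —
PROVED (with `borderDc_pLambda` of `LMR13BoundaryOrbitProofs.lean`): the source's explicit infinite
family on which border determinantal complexity is STRICTLY smaller than determinantal complexity.
Typed literature; nothing here is progress on VP ≠ VNP. [cite: LandsbergManivelRessayre2013, Proposition 3.5.1 (p. 481)] -/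
theorem borderDc_pLambda_lt_determinantalComplexity (hn : Odd n) (h3 : 3 ≤ n) :
    borderDc (pLambda n) n < determinantalComplexity (pLambda n) := by
  rw [borderDc_pLambda hn]
  exact lt_determinantalComplexity_pLambda hn h3

end Main

/-! ### Appendix: Prop. 3.5.1 (b) — the elementary parts -/

section BoundaryComponent

variable {n : ℕ}

/-- `Δ(P_Λ) ⊆ Δ(det_n)` (`n` odd): orbit closures are transitive (`orbitClosure_subset_of_mem_holds`)
and `P_Λ ∈ Δ(det_n)` (Prop. 3.5.1, first assertion, `pLambda_mem_orbitClosure_detPoly`). Part of the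
typed conjunct (b) "`\overline{GL(W)·P_Λ}` is an irreducible … component of the boundary of
`\overline{GL(W)·[det_n]}`" (LMR 2013 p. 481). [cite: LandsbergManivelRessayre2013, Proposition 3.5.1 (p. 481)] -/
theorem orbitClosure_pLambda_subset_orbitClosure_detPoly (hn : Odd n) :
    orbitClosure (pLambda n) ⊆ orbitClosure (detPoly (Fin n) ℂ) :=
  orbitClosure_subset_of_mem_holds (pLambda_mem_orbitClosure_detPoly hn)

/-- `Δ(P_Λ) = \overline{GL(W)·P_Λ}` is IRREDUCIBLE (`n` odd) — the word "irreducible" of conjunct (b)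
of Prop. 3.5.1 (orbit closures of nonzero forms are irreducible, `orbitClosure_isCoeffZariskiIrreducible`;
`P_Λ ≠ 0`, `pLambda_ne_zero`). [cite: LandsbergManivelRessayre2013, Proposition 3.5.1 (p. 481)] -/
theorem orbitClosure_pLambda_isCoeffZariskiIrreducible (hn : Odd n) :
    IsCoeffZariskiIrreducible (orbitClosure (pLambda n)) :=
  orbitClosure_isCoeffZariskiIrreducible (pLambda_isHomogeneous hn) (pLambda_ne_zero hn)

/-- The orbits `GL(W)·P_Λ` and `GL(W)·det_n` are DISJOINT (`n` odd, `n ≥ 3`): `P_Λ` is a genuine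
boundary point ("not contained in the orbit of the determinant", LMR 2013 p. 481; from
`pLambda_not_mem_glOrbit_detPoly` and `glOrbit_eq_of_mem`). [cite: LandsbergManivelRessayre2013, Proposition 3.5.1 (p. 481)] -/
theorem disjoint_glOrbit_pLambda_glOrbit_detPoly (hn : Odd n) (h3 : 3 ≤ n) :
    Disjoint (glOrbit (Fin n × Fin n) ℂ (pLambda n)) (glOrbit (Fin n × Fin n) ℂ (detPoly (Fin n) ℂ)) := by
  rw [Set.disjoint_iff]
  rintro q ⟨hqP, hqD⟩
  apply pLambda_not_mem_glOrbit_detPoly hn h3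
  rw [← glOrbit_eq_of_mem hqD, glOrbit_eq_of_mem hqP]
  exact mem_glOrbit_self _

end BoundaryComponent

end Literature.Computability.AlgebraicComplexity
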